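import Mathlib
import Summits.ResolutionOfSingularities.ResolutionOfSingularities.Theorems.HomologicalConductorNoZenoFullSheafAffine
import HarnessLib

/-!
# Crux `NoZenoR` (stmt-ResolutionOfSingularities-19943), line `sandwich-cluster`, G-layer:
# global sections of `𝒪_X · S`, the maps `𝒪_X ⟶ 𝒪_X · S`, global generation, inclusions

OURS (cell res-hironaka, chain W4.4; KERNEL-L0 §16 R6 row G2 «full-sheaf package», seat res-D-pv-045 AS
res-L0-w44-stub-8). Sequel of `…Theorems.HomologicalConductorNoZenoFullSheaf` (the object
`generatedSheaf V S : X.Modules` = «`𝒪_X · S ⊆ V_X`») and `…FullSheafAffine` (sections over affine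
opens = `Γ(X, U) · S`). This file supplies the maps that presentation / exactness arguments
(G2 (iii) «`Ȟ¹(M~) = 0` from `𝒪_X^N ↠ M~`», G2 (vi)) consume. Nothing of [claim: Hironaka2017] is used.

* `globalSection v hv : (generatedSheaf V S).sections` — the global section with constant value `v`
  (`v` in every stalk lattice), `globalSectionOfMem` for `v ∈ S`;
* **`toGenerated v hv : 𝒪_X ⟶ 𝒪_X · S`**, `g ↦ g • σ_v` (Mathlib `SheafOfModules.unitHomEquiv`), with
  `toGenerated_app` / `fn_toGenerated_app` / `toGenerated_app_one`;
* **`span_range_ofMem_eq_top`, `span_range_toGenerated_one_eq_top`** — GLOBAL GENERATION: over a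
  non-empty affine open `U`, `Γ(U, 𝒪_X · S)` is the `Γ(X, U)`-span of the sections `σ_s|_U`, `s ∈ S`
  (Artin–Verdier (1.1)(ii) «generated by global sections», for `𝒪_X · S`; from `sectionsEquivSpan`);
* `subsheafInclusion h : 𝒪_X · S' ⟶ 𝒪_X · S` for `S' ⊆ S` (same functions), injective on sections.

Everything is proved; no named facts. [this work]

References: M. Artin, J.-L. Verdier, Math. Ann. 270 (1985) 79–82, Lemma (1.1) [`ArtinVerdier1985`].
-/

-- single-problem summit: the doubled namespace component `ResolutionOfSingularities` is forced
set_option linter.dupNamespace false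

noncomputable section

universe u

open CategoryTheory AlgebraicGeometry TopologicalSpace Opposite

namespace Summit.ResolutionOfSingularities.ResolutionOfSingularities.Theorems.NoZeno.SandwichCluster.FullSheaf

variable {X : Scheme.{u}} [IsIntegral X]
variable (V : Type u) [AddCommGroup V] [Module X.functionField V] (S : Set V)

attribute [local instance] stalkModule stalk_isScalarTower fnModule baseModule

/-! ## Global sections and the maps `𝒪_X → 𝒪_X · S`, `g ↦ g • v` -/

/-- **The global section of `𝒪_X · S` with constant value `v`**, for `v` in every stalk lattice, as a
compatible family of sections (Mathlib `SheafOfModules.sections`). [folklore] -/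
def globalSection (v : V) (hv : ∀ x : X, v ∈ stalkSpan V S x) : (generatedSheaf (X := X) V S).sections :=
  PresheafOfModules.sectionsMk (fun U => mkSection V S U.unop v fun x _ => hv x) fun _ _ _ => rfl

/-- Components of `globalSection`. [folklore] -/
@[simp]
theorem globalSection_val (v : V) (hv : ∀ x : X, v ∈ stalkSpan V S x) (U : (X.Opens)ᵒᵖ) :
    (globalSection V S v hv).val U = mkSection V S U.unop v (fun x _ => hv x) := rfl

/-- The global section attached to an element of `S`. [folklore] -/
def globalSectionOfMem (v : V) (hv : v ∈ S) : (generatedSheaf (X := X) V S).sections :=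
  globalSection V S v fun x => subset_stalkSpan V S x hv

/-- Components of `globalSectionOfMem`. [folklore] -/
@[simp]
theorem globalSectionOfMem_val (v : V) (hv : v ∈ S) (U : (X.Opens)ᵒᵖ) :
    (globalSectionOfMem V S v hv).val U = ofMem V S U.unop v hv := rfl

/-- **The morphism `𝒪_X ⟶ 𝒪_X · S`, `g ↦ g • v`** attached to a vector `v` lying in every stalk lattice
(Mathlib `SheafOfModules.unitHomEquiv`). [folklore] -/
def toGenerated (v : V) (hv : ∀ x : X, v ∈ stalkSpan V S x) :
    SheafOfModules.unit X.ringCatSheaf ⟶ generatedSheaf V S :=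
  (generatedSheaf V S).unitHomEquiv.symm (globalSection V S v hv)

/-- `toGenerated v` on sections: `g ↦ g • (section with value v)`. [folklore] -/
theorem toGenerated_app (v : V) (hv : ∀ x : X, v ∈ stalkSpan V S x) (U : X.Opens) (g : Γ(X, U)) :
    ((toGenerated V S v hv).val.app (op U) g : Γ(generatedSheaf V S, U)) =
      g • mkSection V S U v (fun x _ => hv x) :=
  rfl

/-- The values of `toGenerated v`: `(g • σ_v)(y) = g(y) • v`. [folklore] -/
theorem fn_toGenerated_app (v : V) (hv : ∀ x : X, v ∈ stalkSpan V S x) (U : X.Opens) (g : Γ(X, U))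
    (y : U) : fn V S ((toGenerated V S v hv).val.app (op U) g : Γ(generatedSheaf V S, U)) y = evalFn U y g • v := by
  rw [toGenerated_app, fn_smul, fn_mkSection]

/-! ## `𝒪_X · S` is generated by the global sections attached to `S` -/

/-- **Global generation on affines**: over a non-empty AFFINE open `U`, the sections of `𝒪_X · S` are
the `Γ(X, U)`-span of the (restrictions of the) global sections `σ_s`, `s ∈ S` — Artin–Verdier (1.1)(ii)
«generated by global sections», for the object `𝒪_X · S`. [folklore] -/
theorem span_range_ofMem_eq_top {U : X.Opens} (hU : IsAffineOpen U) [Nonempty U] :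
    Submodule.span Γ(X, U) (Set.range fun s : S => (ofMem V S U s.1 s.2 : Γ(generatedSheaf V S, U))) = ⊤ := by
  obtain ⟨x⟩ := ‹Nonempty U›
  let e := sectionsEquivSpan V S hU x
  -- inside `Γ(X,U) · S` the elements of `S` generate everything
  have h1 : Submodule.span Γ(X, U)
      (((↑) : Submodule.span Γ(X, U) S → V) ⁻¹' S) = ⊤ := Submodule.span_span_coe_preimage
  -- transport along `e.symm`
  have h2 : (e.symm : _ →ₗ[Γ(X, U)] _) '' (((↑) : Submodule.span Γ(X, U) S → V) ⁻¹' S) ⊆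
      Set.range fun s : S => (ofMem V S U s.1 s.2 : Γ(generatedSheaf V S, U)) := by
    rintro _ ⟨p, hp, rfl⟩
    refine ⟨⟨(p : V), hp⟩, ?_⟩
    apply e.injective
    rw [LinearEquiv.coe_coe, LinearEquiv.apply_symm_apply]
    exact Subtype.ext rfl
  refine eq_top_iff.mpr ?_
  calc (⊤ : Submodule Γ(X, U) Γ(generatedSheaf V S, U))
      = (⊤ : Submodule Γ(X, U) (Submodule.span Γ(X, U) S)).map (e.symm : _ →ₗ[Γ(X, U)] _) := by
        rw [Submodule.map_top, LinearEquiv.range]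
    _ = (Submodule.span Γ(X, U) (((↑) : Submodule.span Γ(X, U) S → V) ⁻¹' S)).map
          (e.symm : _ →ₗ[Γ(X, U)] _) := by rw [h1]
    _ = Submodule.span Γ(X, U) ((e.symm : _ →ₗ[Γ(X, U)] _) ''
          (((↑) : Submodule.span Γ(X, U) S → V) ⁻¹' S)) := Submodule.map_span _ _
    _ ≤ _ := Submodule.span_mono h2

/-- `toGenerated s` applied to `1` is the section `σ_s` with value `s`. [folklore] -/
theorem toGenerated_app_one (v : V) (hv : ∀ x : X, v ∈ stalkSpan V S x) (U : X.Opens) :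
    ((toGenerated V S v hv).val.app (op U) (1 : Γ(X, U)) : Γ(generatedSheaf V S, U)) =
      mkSection V S U v (fun x _ => hv x) := by
  rw [toGenerated_app, one_smul]

/-- **Sections over an affine open are finite combinations of the `σ_s|_U`** (`s ∈ S`), the `σ_s`
being the images of `1` under the maps `toGenerated s : 𝒪_X ⟶ 𝒪_X · S`: the form of global
generation consumed by presentation maps `𝒪_X^N ⟶ 𝒪_X · S`. [folklore] -/
theorem span_range_toGenerated_one_eq_top {U : X.Opens} (hU : IsAffineOpen U) [Nonempty U] :
    Submodule.span Γ(X, U) (Set.range fun s : S =>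
      ((toGenerated V S s.1 (fun x => subset_stalkSpan V S x s.2)).val.app (op U) (1 : Γ(X, U)) :
        Γ(generatedSheaf V S, U))) = ⊤ := by
  have h : (fun s : S => ((toGenerated V S s.1 (fun x => subset_stalkSpan V S x s.2)).val.app (op U)
      (1 : Γ(X, U)) : Γ(generatedSheaf V S, U)))
      = fun s : S => (ofMem V S U s.1 s.2 : Γ(generatedSheaf V S, U)) := by
    funext s
    rw [toGenerated_app_one]
    rfl
  rw [h]
  exact span_range_ofMem_eq_top V S hU

/-! ## Functoriality in `S`: the inclusions `𝒪_X · S' ⟶ 𝒪_X · S` -/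

/-- **The inclusion `𝒪_X · S' ⟶ 𝒪_X · S` for `S' ⊆ S`** (same functions, larger lattices). [folklore] -/
def subsheafInclusion {S' S : Set V} (h : S' ⊆ S) : generatedSheaf (X := X) V S' ⟶ generatedSheaf V S where
  val := PresheafOfModules.homMk
    { app := fun U => AddCommGrpCat.ofHom
        { toFun := fun s => (⟨fn V S' s, fun x y => fn_apply_eq_fn_apply V S' s x y,
            fun x => Submodule.span_mono h (fn_mem_stalkSpan V S' s x)⟩ : latticeSubmodule V S U.unop)
          map_zero' := rfl
          map_add' := fun _ _ => rfl }
      naturality := fun _ _ _ => rfl }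
    (fun _ _ _ => rfl)

/-- The inclusion preserves the underlying functions. [folklore] -/
@[simp]
theorem fn_subsheafInclusion_app {S' S : Set V} (h : S' ⊆ S) (U : X.Opens) (s : Γ(generatedSheaf V S', U)) :
    fn V S ((subsheafInclusion V h).val.app (op U) s) = fn V S' s := rfl

/-- The inclusion is injective on sections. [folklore] -/
theorem subsheafInclusion_app_injective {S' S : Set V} (h : S' ⊆ S) (U : X.Opens) :
    Function.Injective ((subsheafInclusion V h).val.app (op U)) := fun s s' hss' =>
  section_ext V S' (by rw [← fn_subsheafInclusion_app V h U s, ← fn_subsheafInclusion_app V h U s', hss'])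

end Summit.ResolutionOfSingularities.ResolutionOfSingularities.Theorems.NoZeno.SandwichCluster.FullSheaf

end
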